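import Literature.NumberTheory.EllipticCurves.ComplexMultiplicationShaRubinProofs
import Literature.NumberTheory.EllipticCurves.ComplexMultiplicationMaximalOrderProofs
import Literature.NumberTheory.EllipticCurves.ShaIsogeny
import Literature.NumberTheory.EllipticCurves.ShaIsogenyProofs
import HarnessLib

/-!
# bsd.S28 (Rubin): finiteness of `Ш(E/ℚ)` for CM curves with `L(E,1) ≠ 0` — level 3:
# the isogeny-invariance leaf (Milne, *ADT*, Lemma I.7.1(b)) from the geometric leaf

Third level of the decomposition of `Literature.NumberTheory.EllipticCurves.shaFinite_of_hasCM_of_L_one_ne_zero` (bsd.S28, `Ш`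
part; Rubin, Invent. Math. 89 (1987), §0 Remark (3)) begun in
`ComplexMultiplicationShaProofs.lean` (level 1: Remark (3) from Theorem A over the CM field,
Deuring, modularity, the `ℚ`-isogeny to a maximal-order curve, Knapp 11.67 and the isogeny
invariance of the finiteness of `Ш`) and `ComplexMultiplicationShaRubinProofs.lean` (level 2:
Theorem A for `E_K` from its two printed halves, Thm. 6.6 and §10). Here the level-1 leaf

* `shaFinite_iff_of_isIsogenous` — Milne, *Arithmetic Duality Theorems*, Ch. I, Lemma 7.1(b)
  (finiteness of `Ш` is an isogeny invariant; Cassels 1965 for elliptic curves) —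

is **derived** (`shaFinite_iff_of_isIsogenous_of_hasLocalPointsMaps`) from the cohomological
formalism proved in `ShaIsogeny.lean` (`H¹(φ)`, `Ш(φ)`, `ker Ш(φ) ⊆ Ш[deg φ]` via the dual
isogeny — `Isogeny.exists_dual_of_isElliptic`, Silverman III.6.1(a), proved — and the finiteness
of `Ш[n]` — `WeierstrassCurve.finite_sha_torsionBy_holds`, Silverman X.4.2(b), proved) and the
single *geometric* named fact `WeierstrassCurve.Isogeny.hasLocalPointsMaps W W'` (an isogeny
defined over `K` acts, `Γ_{K_v}`-equivariantly and compatibly with `K̄ → K̄_v`, on the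
`K̄_v`-points; Silverman, *AEC*, I.§3, II.§2, III.4), which the tree cannot yet construct (its
isogenies are recorded by their action on `K̄`-points only).

For the target only the direction "`Ш(E'/ℚ)` finite ⇒ `Ш(E/ℚ)` finite" along the `ℚ`-isogeny
`E → E'` to a maximal-order curve is used, so the `HasCM` form needs the geometric fact over `ℚ`
alone (`shaFinite_of_hasCM_of_L_one_ne_zero_of_facts_of_hasLocalPointsMaps`). Moreover the
level-1 leaf `exists_isIsogenous_j_mem_maximalCMJInvariants_of_hasCM` (Silverman, *Advanced
Topics*, Exercise 2.12(b)) has meanwhile been reduced in the tree to the classification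
`hasCM_iff_j_mem` of the rational CM `j`-invariants (Heegner–Baker–Stark; Silverman *AEC*
C.11.3.1–2), the isogenies being constructed explicitly
(`ComplexMultiplicationMaximalOrderProofs.lean`). The resulting state of bsd.S28 (`Ш` part) is
recorded by `shaFinite_of_hasCM_of_L_one_ne_zero_of_level3`: it follows, sorry-free, from

1. Rubin 1987, Thm. 6.6 for `E_K` (`Rubin1987_sha_torsionBy_eq_bot_cofinite`, level 2);
2. Rubin 1987, §10: `Ш(E_K/K)_{𝔭^∞}` finite for all `𝔭` (`Rubin1987_sha_primary_finite`, level 2);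
3. Deuring, `L(E_K/K, s) = L(E/ℚ, s)²` (`Deuring_LFunction_baseChange_cmField`, level 1);
4. modularity, the entire continuation of `L(E/ℚ, s)` (`hasEntireLFunction_rat`);
5. the classification of CM `j`-invariants in `ℚ` (`hasCM_iff_j_mem`);
6. Knapp, Thm. 11.67: isogenous curves have the same `L`-function (`LFunction_eq_of_isIsogenous`);
7. isogenies over `ℚ` act on local points (`Isogeny.hasLocalPointsMaps W W'` for `W, W'/ℚ`),

everything else — the reduction of Remark (3) to Theorem A, `Ш` torsion with finite primary
parts ⇒ finite, `Ш(E/ℚ) → Ш(E_K/K)` with finite kernel, the explicit isogenies to maximal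
order, the dual isogeny, `Ш[n]` finite, `Ш(φ)` and Milne's Lemma I.7.1(b) — being proved.

## Update: the geometric leaf is proved, so Milne's Lemma I.7.1(b) is discharged

`ShaIsogenyProofs.lean` has since **proved** the geometric leaf
(`WeierstrassCurve.Isogeny.hasLocalPointsMaps_holds`: an isogeny over `K` acts on the points over
every extension field, by base change of the isogeny, `IsogenyBaseChange.lean`). Hence the
level-1 leaf is now a theorem: `shaFinite_iff_of_isIsogenous_holds` (end of this file) discharges
the named fact `shaFinite_iff_of_isIsogenous` of `ComplexMultiplicationShaProofs.lean` — Milne,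
*ADT*, Lemma I.7.1(b) for elliptic curves over number fields, unconditionally — and item 7 of the
list above is no longer a hypothesis of bsd.S28 (`Ш` part).

## References

* J. S. Milne, *Arithmetic Duality Theorems*, 2nd ed. (2006), Ch. I, Lemma 7.1(b) and its proof,
  p. 96. [MilneADT2006]
* K. Rubin, Invent. Math. 89 (1987), §0 Remark (3) (p. 528), §10 (pp. 548–549). [Rubin1987Sha]
* J. H. Silverman, *The Arithmetic of Elliptic Curves*, 2nd ed. (2009), III.4, III.6.1, X.4.2,
  C.11.3. [SilvermanAEC2009]
-/

noncomputable section

open scoped Classical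

open WeierstrassCurve

namespace Literature.NumberTheory.EllipticCurves

/-- **The level-1 leaf `shaFinite_iff_of_isIsogenous` (Milne, *ADT*, Lemma I.7.1(b)) from the
geometric leaf**: if isogenies over number fields act on local points
(`Isogeny.hasLocalPointsMaps`, for both `(E, E')` and `(E', E)`), then finiteness of `Ш` is an
isogeny invariant for elliptic curves over number fields
(`WeierstrassCurve.IsIsogenous.shaFinite_iff`, `ShaIsogeny.lean`: dual isogeny, `Ш[n]` finite
and the functoriality of `Ш`, all proved). [cite: MilneADT2006, Ch. I Lemma 7.1(b), p. 96] -/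
theorem shaFinite_iff_of_isIsogenous_of_hasLocalPointsMaps
    (hloc : ∀ (K : Type) [Field K] [NumberField K] (W W' : WeierstrassCurve K),
      Isogeny.hasLocalPointsMaps W W') :
    shaFinite_iff_of_isIsogenous := by
  intro K _ _ W W' _ _ hiso
  exact hiso.shaFinite_iff (hloc K W W') (hloc K W' W)

/-- **Reduction of the `HasCM` form to the maximal-order case, with the isogeny step proved up
to the geometric leaf over `ℚ`.** For `E/ℚ` with CM and `L(E/ℚ, 1) ≠ 0`: `E` is `ℚ`-isogenous,
by some `φ : E → E'`, to `E'` with CM by `𝓞_K` (`hR1`); `L(E', 1) = L(E, 1) ≠ 0` (`hR2`, Knapp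
11.67); `Ш(E'/ℚ)` is finite (`h9`, the maximal-order case); and `Ш(E/ℚ)` is finite because
`Ш(φ) : Ш(E/ℚ) → Ш(E'/ℚ)` has finite kernel (`WeierstrassCurve.Isogeny.shaFinite_of_shaFinite`:
dual isogeny and `Ш[deg φ]` finite, proved), granted that `φ` acts on local points (`hloc`).
Only this direction of Milne's Lemma I.7.1(b) is needed, exactly as in Rubin (1987), §10, p. 548
("proving Theorem A for the isogenous curve will imply the theorem for `E`").
[cite: Rubin1987Sha, §0 Remark (3) and §10, p. 548] [cite: MilneADT2006, Ch. I Lemma 7.1(b)] -/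
theorem shaFinite_of_hasCM_of_L_one_ne_zero_of_facts_of_hasLocalPointsMaps
    (h9 : shaFinite_of_j_mem_maximalCMJInvariants_of_L_one_ne_zero)
    (hR1 : exists_isIsogenous_j_mem_maximalCMJInvariants_of_hasCM)
    (hR2 : LFunction_eq_of_isIsogenous)
    (hloc : ∀ (W W' : WeierstrassCurve ℚ), Isogeny.hasLocalPointsMaps W W') :
    shaFinite_of_hasCM_of_L_one_ne_zero := by
  intro W _ hCM hL
  obtain ⟨W', hW', hiso, hj⟩ := hR1 W hCM
  haveI := hW'
  have hL' : W'.entireLFunction 1 ≠ 0 := by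
    rwa [← entireLFunction_eq_of_isIsogenous hR2 hiso]
  obtain ⟨φ⟩ := hiso
  exact φ.shaFinite_of_shaFinite (hloc W W' φ) (h9 W' hj hL')

/-- **bsd.S28 (`Ш` part) after three levels of decomposition.**
`shaFinite_of_hasCM_of_L_one_ne_zero` (`E/ℚ` with CM and `L(E/ℚ, 1) ≠ 0 ⇒ Ш(E/ℚ)` finite;
Rubin 1987, §0 Remark (3)) follows, sorry-free, from: Rubin's Theorem 6.6 (`h66`) and §10
(`h10`) for `E_K` — the two halves of Theorem A —, Deuring's theorem (`hD`), modularity (`hmod`),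
the classification of rational CM `j`-invariants (`h13`), Knapp's Thm. 11.67 (`hR2`) and the
action of `ℚ`-isogenies on local points (`hloc`); with, proved in the tree: Theorem A from its
halves (`Rubin1987_shaFinite_baseChange_cmField_of_level2`), Remark (3) from Theorem A
(`shaFinite_of_j_mem_maximalCMJInvariants_of_L_one_ne_zero_of_facts`), the explicit isogenies
to maximal order (`exists_isIsogenous_j_mem_maximalCMJInvariants_of_hasCM_of_hasCM_iff_j_mem`)
and the isogeny step (`shaFinite_of_hasCM_of_L_one_ne_zero_of_facts_of_hasLocalPointsMaps`).
[cite: Rubin1987Sha, Thm. A, §0 Remark (3), Thm. 6.6 and §10]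
[cite: MilneADT2006, Ch. I Lemma 7.1(b)] -/
theorem shaFinite_of_hasCM_of_L_one_ne_zero_of_level3
    (h66 : Rubin1987_sha_torsionBy_eq_bot_cofinite) (h10 : Rubin1987_sha_primary_finite)
    (hD : Deuring_LFunction_baseChange_cmField) (hmod : hasEntireLFunction_rat)
    (h13 : hasCM_iff_j_mem) (hR2 : LFunction_eq_of_isIsogenous)
    (hloc : ∀ (W W' : WeierstrassCurve ℚ), Isogeny.hasLocalPointsMaps W W') :
    shaFinite_of_hasCM_of_L_one_ne_zero :=
  shaFinite_of_hasCM_of_L_one_ne_zero_of_facts_of_hasLocalPointsMaps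
    (shaFinite_of_j_mem_maximalCMJInvariants_of_L_one_ne_zero_of_facts
      (Rubin1987_shaFinite_baseChange_cmField_of_level2 h66 h10) hD hmod)
    (exists_isIsogenous_j_mem_maximalCMJInvariants_of_hasCM_of_hasCM_iff_j_mem h13) hR2 hloc

/-! ### The isogeny-invariance leaf, discharged -/

/-- **Finiteness of `Ш` is an isogeny invariant — the named fact `shaFinite_iff_of_isIsogenous`
(`ComplexMultiplicationShaProofs.lean`), proved.** Milne, *Arithmetic Duality Theorems*, Ch. I,
Lemma 7.1(b), p. 96: *"Let `A` and `B` be isogenous abelian varieties over a global field `K` …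
If one of `Ш(A)`, `Ш(B)` is finite, then so also is the other"*, here for `K`-isogenous elliptic
curves `E, E'` over a number field `K` (characteristic `0`, so Milne's degree condition is void)
and the tree's `Ш(E/K) ⊆ H¹(K, E)` (`WeierstrassCurve.sha`). Proof exactly as printed (Milne,
loc. cit.): `ker Ш(f) ⊆ Ш(E/K)[deg f]` via the dual isogeny `g`, `g ∘ f = [deg f]`, and
`Ш[n]` is finite — all proved in `ShaIsogeny.lean` — combined, through
`shaFinite_iff_of_isIsogenous_of_hasLocalPointsMaps`, with the geometric input that isogenies act
on local points, proved in `ShaIsogenyProofs.lean` (`Isogeny.hasLocalPointsMaps_holds`).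
Equivalently, `WeierstrassCurve.IsIsogenous.shaFinite_iff_shaFinite` at universe level `0`.
[cite: MilneADT2006, Ch. I Lemma 7.1(b), p. 96] -/
theorem shaFinite_iff_of_isIsogenous_holds : shaFinite_iff_of_isIsogenous :=
  shaFinite_iff_of_isIsogenous_of_hasLocalPointsMaps fun _ _ _ W W' =>
    Isogeny.hasLocalPointsMaps_holds W W'

/-- The `HasCM` form of bsd.S28 (`Ш` part) from the maximal-order case, Silverman's
Exercise 2.12(b) and Knapp's Thm. 11.67 alone: `shaFinite_of_hasCM_of_L_one_ne_zero_of_facts`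
(`ComplexMultiplicationShaProofs.lean`) with its fourth hypothesis, the isogeny invariance of
the finiteness of `Ш`, discharged by `shaFinite_iff_of_isIsogenous_holds`.
[cite: Rubin1987Sha, §0 Remark (3) and §10, p. 548] [cite: MilneADT2006, Ch. I Lemma 7.1(b)] -/
theorem shaFinite_of_hasCM_of_L_one_ne_zero_of_maximalOrder_facts
    (h9 : shaFinite_of_j_mem_maximalCMJInvariants_of_L_one_ne_zero)
    (hR1 : exists_isIsogenous_j_mem_maximalCMJInvariants_of_hasCM)
    (hR2 : LFunction_eq_of_isIsogenous) : shaFinite_of_hasCM_of_L_one_ne_zero :=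
  shaFinite_of_hasCM_of_L_one_ne_zero_of_facts h9 hR1 hR2 shaFinite_iff_of_isIsogenous_holds

end Literature.NumberTheory.EllipticCurves

end
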